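import Summits.ResolutionOfSingularities.ResolutionOfSingularities.Theorems.FrobeniusClosingPatchingRelPerfectDepthPhaseCReachableFamilies
import HarnessLib

/-!
# Crux `PatchingRelPerfect` (stmt-ResolutionOfSingularities-16161), chain W5.2 — F7(β) (β-AX) PHASE C,
# REACHABLE FAMILIES (iii): the S1♯ run of the contact-three tangent-hosts pole `(α₃)`

[OURS · L1 W5.2 · F7(β) (β-AX) Phase C · res-L1-w52-plan-1 NAMING G11-7 (1) (T2″) / ANSWER 2026-08-27T16:09:56Z «RUNS»;
companion of `…DepthPhaseCReachableFamilies` (`(α₂)`) and `…DepthPhaseCReachableFamiliesPocket`] res-L1-w52-stub-2 g5.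
Replaces the role of NO printed item; NOT a statement of the manuscript under review (AI-written, weaker than expert review).
MACHINE CHECK, at ring level over an ARBITRARY commutative ring, of the S1♯ (= TMN, RULING G11-14) run of

  `(α₃)`: `K = (x) + (x + y³) + (z t²)`, hosts `H₁ = V(x)` (bare), `H₂ = V(x + y³)`, members `E″ = V(t)`, `F̃ = V(z)`

(the `m = 3` member of tri-2's family F1; reachability is asserted by tri-2 v11.3 N3 for `(α) = (α₂)` only — `(α₃)` is the
next instance of idea-1's LT-2, typed at plan-1's request «(α₂), (α₃) explicitly»).  END in the STRONG currency (FLAG F1);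
as for `(α₂)` the run ends with EMPTY COSUPPORT on every branch, so END holds in every currency.  Substitution identities
only (the Rees-chart image pattern is `…ReachableFamilies` §2, verbatim); the one-step letter laws are res-L1-w52-stub-1's.

THE RUN (states renamed after each move; the newest exceptional takes the letter of the centre coordinate of its chart):
* move 1, `W₁ = V(x, y, t) ⊂ E″` (TB2: `ord N = 2` vs `1`; `alpha3_le`): `x ↦ (g)` (`alpha3X`); `y ↦ g · A₁`,
  `A₁ = (x) + (x + y²) + (z y t²)` (`alpha3Y`); `t ↦ g · B₁`, `B₁ = (x) + (x + t² y³) + (z t)` (`alpha3T`).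
* BRANCH B (worst, `2m = 6` moves): move 2 `W₂ = H₁′ ∩ F₁ = V(x, t)` (surface; `B1_3_le`, `B1_3X` `(h)`, `B1_3T` `h · B₂`,
  `B₂ = (x) + (x + t y³) + (z)`); move 3 `W₃ = V(x, y, z)` (TM: contact `3` vs `1`; `B2_3_le`, `B2_3X`/`B2_3Z` `(k)`,
  `B2_3Y` `k · B₃`, `B₃ = (x) + (x + t y²) + (z)`); move 4 `W₄ = V(x, y, z)` (TM: `2` vs `1`; `B3_3_le`, `B3_3X`/`B3_3Z` `(l)`,
  `B3_3Y` `l · B₄`, `B₄ = (x) + (x + t y) + (z)`); move 5 `W₅ = V(x, y, z)` (TMN TIE with `V(x, t, z)`, both of value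
  `(1, 1)`, free — the other choice also ends in one further move; `B4_3_le`, `B4_3X`/`B4_3Z` `(m)`, `B4_3Y` `m · C`,
  `C = (x) + (x + t) + (z)`); move 6 `W₆ = V(x, t, z)` (`C_le`; `CX`, `CT`, `CZ` all `(n)`).
* BRANCH A (`5` moves): move 2 `W₂ = H₁′ ∩ F₁ = V(x, y)` (surface; `A1_3_le`, `A1_3X` `(h)`, `A1_3Y` `h · A₂`,
  `A₂ = (x) + (x + y) + (z t²)`); move 3 `W₃ = V(x, y, t)` (TM tie `1,1`; TB2: `ord N = 2` vs `1`; `A2_3_le`, `A2_3X`/`A2_3Y`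
  `(k)`, `A2_3T` `k · A₃`, `A₃ = (x) + (x + y) + (z t)`); move 4 `W₄ = V(x, y, z)` (TMN tie with `V(x, y, t)`, free;
  `A3_3_le`, `A3_3X`/`A3_3Y` `(l)`, `A3_3Z` `l · C(x, t, y)`); move 5 = the `C`-move (`CX`, `CT`, `CZ`).
Measure data `(dim W, host contact min_j ord_W M_j, ord_W N)` along branch B: `(1,3,2) → (2,1,1) → (1,3,1) → (1,2,1) →
(1,1,1) → (1,1,1)`; along branch A: `(1,3,2) → (2,1,1) → (1,1,2) → (1,1,1) → (1,1,1)`.  Every move has `ν = 1` and both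
hosts of order `1` along the centre (`*_le`: the state ideal lies in the centre ideal).

Fact-free; design / termination evidence for X3 (idea-1 LT-2, tri-2 kit j283236 TMN value `6`); no E-side content.

## References
* The Stacks Project, Tags 0804, 0BIQ (affine blow-up algebras and their charts). [StacksProject]
* J. Kollár, *Lectures on Resolution of Singularities* (2007), (3.111) Step 3 (monomial bookkeeping). [Kollar2007]
-/

-- `Summit.<Summit>.<Sub>.Theorems` with `Sub = Summit` (single-conjunct summit, D-0017)
set_option linter.dupNamespace false

noncomputable section

open IsLocalRing Literature.AlgebraicGeometry.Resolution

namespace Summit.ResolutionOfSingularities.ResolutionOfSingularities.Theorems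

universe u

namespace DepthPhaseCRuns

open DepthPhaseC CuspMember

/-- `(α_m)`: `K = (x) + (x + y^m) + (z t²)`. -/
local notation3 "Kα[" x "," y "," z "," t "," m "]" =>
  (Ideal.span {x} ⊔ Ideal.span {x + y ^ m} ⊔ Ideal.span {z * t ^ 2})
/-- Branch A after move 1: `A₁ = (x) + (x + y²) + (z y t²)`. -/
local notation3 "A13[" x "," y "," z "," t "]" =>
  (Ideal.span {x} ⊔ Ideal.span {x + y ^ 2} ⊔ Ideal.span {z * y * t ^ 2})
/-- Branch A after move 2: `A₂ = (x) + (x + y) + (z t²)`. -/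
local notation3 "A23[" x "," y "," z "," t "]" =>
  (Ideal.span {x} ⊔ Ideal.span {x + y} ⊔ Ideal.span {z * t ^ 2})
/-- Branch A after move 3: `A₃ = (x) + (x + y) + (z t)`. -/
local notation3 "A33[" x "," y "," z "," t "]" =>
  (Ideal.span {x} ⊔ Ideal.span {x + y} ⊔ Ideal.span {z * t})
/-- Branch B after move 1: `B₁ = (x) + (x + t² y³) + (z t)`. -/
local notation3 "B13[" x "," y "," z "," t "]" =>
  (Ideal.span {x} ⊔ Ideal.span {x + t ^ 2 * y ^ 3} ⊔ Ideal.span {z * t})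
/-- Branch B after move 2: `B₂ = (x) + (x + t y³) + (z)`. -/
local notation3 "B23[" x "," y "," z "," t "]" =>
  (Ideal.span {x} ⊔ Ideal.span {x + t * y ^ 3} ⊔ Ideal.span {z})
/-- Branch B after move 3: `B₃ = (x) + (x + t y²) + (z)`. -/
local notation3 "B33[" x "," y "," z "," t "]" =>
  (Ideal.span {x} ⊔ Ideal.span {x + t * y ^ 2} ⊔ Ideal.span {z})
/-- Branch B after move 4: `B₄ = (x) + (x + t y) + (z)`. -/
local notation3 "B43[" x "," y "," z "," t "]" =>
  (Ideal.span {x} ⊔ Ideal.span {x + t * y} ⊔ Ideal.span {z})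
/-- The common last state `C = (x) + (x + t) + (z)`. -/
local notation3 "Cfin[" x "," z "," t "]" => (Ideal.span {x} ⊔ Ideal.span {x + t} ⊔ Ideal.span {z})

variable {A : Type u} [CommRing A]

/-! ## §1 Move 1 -/

/-- **Move 1 is legal**: `K ≤ (x, y, t)`. [folklore] -/
theorem alpha3_le (x y z t : A) : Kα[x, y, z, t, 3] ≤ Ideal.span (Set.range ![x, y, t]) := by
  rw [span_range_vec3]
  refine sup_le (sup_le (le_sup_of_le_left le_sup_left) ?_) ?_
  · rw [Ideal.span_singleton_le_iff_mem]
    exact Ideal.add_mem _ (Ideal.mem_sup_left (Ideal.mem_sup_left (Ideal.mem_span_singleton_self x)))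
      (Ideal.mem_sup_left (Ideal.mem_sup_right (Ideal.mem_span_singleton.mpr ⟨y ^ 2, by ring⟩)))
  · rw [Ideal.span_singleton_le_iff_mem]
    exact Ideal.mem_sup_right (Ideal.mem_span_singleton.mpr ⟨z * t, by ring⟩)

/-- **Move 1, `x`-chart**: `(g)`. [folklore] -/
theorem alpha3X (y' z t' g : A) : Kα[g, g * y', z, g * t', 3] = Ideal.span {g} :=
  span_sup_sup_eq ⟨1 + g ^ 2 * y' ^ 3, by ring⟩ ⟨z * g * t' ^ 2, by ring⟩

/-- **Move 1, `y`-chart**: `g · A₁(x′, g, z, t′)`. [folklore] -/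
theorem alpha3Y (x' z t' g : A) : Kα[g * x', g, z, g * t', 3] = Ideal.span {g} * A13[x', g, z, t'] := by
  have e1 : g * x' + g ^ 3 = g * (x' + g ^ 2) := by ring
  have e2 : z * (g * t') ^ 2 = g * (z * g * t' ^ 2) := by ring
  rw [e1, e2]
  exact (span_singleton_mul_sup₃ _ _ _ _).symm

/-- **Move 1, `t`-chart**: `g · B₁(x′, y′, z, g)`. [folklore] -/
theorem alpha3T (x' y' z g : A) : Kα[g * x', g * y', z, g, 3] = Ideal.span {g} * B13[x', y', z, g] := by
  have e1 : g * x' + (g * y') ^ 3 = g * (x' + g ^ 2 * y' ^ 3) := by ring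
  have e2 : z * g ^ 2 = g * (z * g) := by ring
  rw [e1, e2]
  exact (span_singleton_mul_sup₃ _ _ _ _).symm

/-! ## §2 Branch B -/

/-- **Move 2 (B) is legal**: `B₁ ≤ (x, t)`. [folklore] -/
theorem B1_3_le (x y z t : A) : B13[x, y, z, t] ≤ Ideal.span (Set.range ![x, t]) := by
  rw [span_range_vec2]
  refine sup_le (sup_le le_sup_left ?_) ?_
  · rw [Ideal.span_singleton_le_iff_mem]
    exact Ideal.add_mem _ (Ideal.mem_sup_left (Ideal.mem_span_singleton_self x))
      (Ideal.mem_sup_right (Ideal.mem_span_singleton.mpr ⟨t * y ^ 3, by ring⟩))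
  · rw [Ideal.span_singleton_le_iff_mem]
    exact Ideal.mem_sup_right (Ideal.mem_span_singleton.mpr ⟨z, by ring⟩)

/-- **Move 2 (B), `x`-chart**: `(h)`. [folklore] -/
theorem B1_3X (y z t' h : A) : B13[h, y, z, h * t'] = Ideal.span {h} :=
  span_sup_sup_eq ⟨1 + h * t' ^ 2 * y ^ 3, by ring⟩ ⟨z * t', by ring⟩

/-- **Move 2 (B), `t`-chart**: `h · B₂(x′, y, z, h)`. [folklore] -/
theorem B1_3T (x' y z h : A) : B13[h * x', y, z, h] = Ideal.span {h} * B23[x', y, z, h] := by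
  have e1 : h * x' + h ^ 2 * y ^ 3 = h * (x' + h * y ^ 3) := by ring
  have e2 : z * h = h * z := by ring
  rw [e1, e2]
  exact (span_singleton_mul_sup₃ _ _ _ _).symm

/-- **Move 3 (B) is legal**: `B₂ ≤ (x, y, z)`. [folklore] -/
theorem B2_3_le (x y z t : A) : B23[x, y, z, t] ≤ Ideal.span (Set.range ![x, y, z]) := by
  rw [span_range_vec3]
  refine sup_le (sup_le (le_sup_of_le_left le_sup_left) ?_) le_sup_right
  rw [Ideal.span_singleton_le_iff_mem]
  exact Ideal.add_mem _ (Ideal.mem_sup_left (Ideal.mem_sup_left (Ideal.mem_span_singleton_self x)))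
    (Ideal.mem_sup_left (Ideal.mem_sup_right (Ideal.mem_span_singleton.mpr ⟨t * y ^ 2, by ring⟩)))

/-- **Move 3 (B), `x`-chart**: `(k)`. [folklore] -/
theorem B2_3X (y' z' t k : A) : B23[k, k * y', k * z', t] = Ideal.span {k} :=
  span_sup_sup_eq ⟨1 + t * k ^ 2 * y' ^ 3, by ring⟩ ⟨z', by ring⟩

/-- **Move 3 (B), `z`-chart**: `(k)`. [folklore] -/
theorem B2_3Z (x' y' t k : A) : B23[k * x', k * y', k, t] = Ideal.span {k} :=
  sup_sup_span_eq ⟨x', by ring⟩ ⟨x' + t * k ^ 2 * y' ^ 3, by ring⟩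

/-- **Move 3 (B), `y`-chart**: `k · B₃(x′, k, z′, t)`. [folklore] -/
theorem B2_3Y (x' z' t k : A) : B23[k * x', k, k * z', t] = Ideal.span {k} * B33[x', k, z', t] := by
  have e1 : k * x' + t * k ^ 3 = k * (x' + t * k ^ 2) := by ring
  rw [e1]
  exact (span_singleton_mul_sup₃ _ _ _ _).symm

/-- **Move 4 (B) is legal**: `B₃ ≤ (x, y, z)`. [folklore] -/
theorem B3_3_le (x y z t : A) : B33[x, y, z, t] ≤ Ideal.span (Set.range ![x, y, z]) := by
  rw [span_range_vec3]
  refine sup_le (sup_le (le_sup_of_le_left le_sup_left) ?_) le_sup_right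
  rw [Ideal.span_singleton_le_iff_mem]
  exact Ideal.add_mem _ (Ideal.mem_sup_left (Ideal.mem_sup_left (Ideal.mem_span_singleton_self x)))
    (Ideal.mem_sup_left (Ideal.mem_sup_right (Ideal.mem_span_singleton.mpr ⟨t * y, by ring⟩)))

/-- **Move 4 (B), `x`-chart**: `(l)`. [folklore] -/
theorem B3_3X (y' z' t l : A) : B33[l, l * y', l * z', t] = Ideal.span {l} :=
  span_sup_sup_eq ⟨1 + t * l * y' ^ 2, by ring⟩ ⟨z', by ring⟩

/-- **Move 4 (B), `z`-chart**: `(l)`. [folklore] -/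
theorem B3_3Z (x' y' t l : A) : B33[l * x', l * y', l, t] = Ideal.span {l} :=
  sup_sup_span_eq ⟨x', by ring⟩ ⟨x' + t * l * y' ^ 2, by ring⟩

/-- **Move 4 (B), `y`-chart**: `l · B₄(x′, l, z′, t)`. [folklore] -/
theorem B3_3Y (x' z' t l : A) : B33[l * x', l, l * z', t] = Ideal.span {l} * B43[x', l, z', t] := by
  have e1 : l * x' + t * l ^ 2 = l * (x' + t * l) := by ring
  rw [e1]
  exact (span_singleton_mul_sup₃ _ _ _ _).symm

/-- **Move 5 (B) is legal**: `B₄ ≤ (x, y, z)` (TMN tie with `V(x, t, z)`, free). [folklore] -/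
theorem B4_3_le (x y z t : A) : B43[x, y, z, t] ≤ Ideal.span (Set.range ![x, y, z]) := by
  rw [span_range_vec3]
  refine sup_le (sup_le (le_sup_of_le_left le_sup_left) ?_) le_sup_right
  rw [Ideal.span_singleton_le_iff_mem]
  exact Ideal.add_mem _ (Ideal.mem_sup_left (Ideal.mem_sup_left (Ideal.mem_span_singleton_self x)))
    (Ideal.mem_sup_left (Ideal.mem_sup_right (Ideal.mem_span_singleton.mpr ⟨t, by ring⟩)))

/-- **Move 5 (B), `x`-chart**: `(m)`. [folklore] -/
theorem B4_3X (y' z' t m : A) : B43[m, m * y', m * z', t] = Ideal.span {m} :=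
  span_sup_sup_eq ⟨1 + t * y', by ring⟩ ⟨z', by ring⟩

/-- **Move 5 (B), `z`-chart**: `(m)`. [folklore] -/
theorem B4_3Z (x' y' t m : A) : B43[m * x', m * y', m, t] = Ideal.span {m} :=
  sup_sup_span_eq ⟨x', by ring⟩ ⟨x' + t * y', by ring⟩

/-- **Move 5 (B), `y`-chart**: `m · C(x′, z′, t)`, `C = (x) + (x + t) + (z)`. [folklore] -/
theorem B4_3Y (x' z' t m : A) : B43[m * x', m, m * z', t] = Ideal.span {m} * Cfin[x', z', t] := by
  have e1 : m * x' + t * m = m * (x' + t) := by ring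
  rw [e1]
  exact (span_singleton_mul_sup₃ _ _ _ _).symm

/-! ## §3 The last move, common to both branches: `C = (x) + (x + t) + (z)` under `V(x, t, z)` -/

/-- **The `C`-move is legal**: `C ≤ (x, t, z)`. [folklore] -/
theorem C_le (x z t : A) : Cfin[x, z, t] ≤ Ideal.span (Set.range ![x, t, z]) := by
  rw [span_range_vec3]
  refine sup_le (sup_le (le_sup_of_le_left le_sup_left) ?_) le_sup_right
  rw [Ideal.span_singleton_le_iff_mem]
  exact Ideal.add_mem _ (Ideal.mem_sup_left (Ideal.mem_sup_left (Ideal.mem_span_singleton_self x)))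
    (Ideal.mem_sup_left (Ideal.mem_sup_right (Ideal.mem_span_singleton_self t)))

/-- **`C`-move, `x`-chart**: `(n)`. [folklore] -/
theorem CX (z' t' n : A) : Cfin[n, n * z', n * t'] = Ideal.span {n} :=
  span_sup_sup_eq ⟨1 + t', by ring⟩ ⟨z', by ring⟩

/-- **`C`-move, `t`-chart**: `n · ((x′) + (x′ + 1) + (z′)) = (n)`. [folklore] -/
theorem CT (x' z' n : A) : Cfin[n * x', n * z', n] = Ideal.span {n} := by
  have e1 : n * x' + n = n * (x' + 1) := by ring
  rw [e1, ← span_singleton_mul_sup₃, sup₃_eq_top_of_unit_step, Ideal.mul_top]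

/-- **`C`-move, `z`-chart**: `(n)` — END of the run (empty cosupport). [folklore] -/
theorem CZ (x' t' n : A) : Cfin[n * x', n, n * t'] = Ideal.span {n} :=
  sup_sup_span_eq ⟨x', by ring⟩ ⟨x' + t', by ring⟩

/-! ## §4 Branch A -/

/-- **Move 2 (A) is legal**: `A₁ ≤ (x, y)`. [folklore] -/
theorem A1_3_le (x y z t : A) : A13[x, y, z, t] ≤ Ideal.span (Set.range ![x, y]) := by
  rw [span_range_vec2]
  refine sup_le (sup_le le_sup_left ?_) ?_
  · rw [Ideal.span_singleton_le_iff_mem]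
    exact Ideal.add_mem _ (Ideal.mem_sup_left (Ideal.mem_span_singleton_self x))
      (Ideal.mem_sup_right (Ideal.mem_span_singleton.mpr ⟨y, by ring⟩))
  · rw [Ideal.span_singleton_le_iff_mem]
    exact Ideal.mem_sup_right (Ideal.mem_span_singleton.mpr ⟨z * t ^ 2, by ring⟩)

/-- **Move 2 (A), `x`-chart**: `(h)`. [folklore] -/
theorem A1_3X (y' z t h : A) : A13[h, h * y', z, t] = Ideal.span {h} :=
  span_sup_sup_eq ⟨1 + h * y' ^ 2, by ring⟩ ⟨z * y' * t ^ 2, by ring⟩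

/-- **Move 2 (A), `y`-chart**: `h · A₂(x′, h, z, t)`. [folklore] -/
theorem A1_3Y (x' z t h : A) : A13[h * x', h, z, t] = Ideal.span {h} * A23[x', h, z, t] := by
  have e1 : h * x' + h ^ 2 = h * (x' + h) := by ring
  have e2 : z * h * t ^ 2 = h * (z * t ^ 2) := by ring
  rw [e1, e2]
  exact (span_singleton_mul_sup₃ _ _ _ _).symm

/-- **Move 3 (A) is legal**: `A₂ ≤ (x, y, t)` (TB2: `ord N = 2` on `V(x,y,t)` vs `1` on `V(x,y,z)`). [folklore] -/
theorem A2_3_le (x y z t : A) : A23[x, y, z, t] ≤ Ideal.span (Set.range ![x, y, t]) := by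
  rw [span_range_vec3]
  refine sup_le (sup_le (le_sup_of_le_left le_sup_left) ?_) ?_
  · rw [Ideal.span_singleton_le_iff_mem]
    exact Ideal.add_mem _ (Ideal.mem_sup_left (Ideal.mem_sup_left (Ideal.mem_span_singleton_self x)))
      (Ideal.mem_sup_left (Ideal.mem_sup_right (Ideal.mem_span_singleton_self y)))
  · rw [Ideal.span_singleton_le_iff_mem]
    exact Ideal.mem_sup_right (Ideal.mem_span_singleton.mpr ⟨z * t, by ring⟩)

/-- **Move 3 (A), `x`-chart**: `(k)`. [folklore] -/
theorem A2_3X (y' z t' k : A) : A23[k, k * y', z, k * t'] = Ideal.span {k} :=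
  span_sup_sup_eq ⟨1 + y', by ring⟩ ⟨z * k * t' ^ 2, by ring⟩

/-- **Move 3 (A), `y`-chart**: `k · ((x′) + (x′ + 1) + (z k t′²)) = (k)`. [folklore] -/
theorem A2_3Y (x' z t' k : A) : A23[k * x', k, z, k * t'] = Ideal.span {k} := by
  have e1 : k * x' + k = k * (x' + 1) := by ring
  have e2 : z * (k * t') ^ 2 = k * (z * k * t' ^ 2) := by ring
  rw [e1, e2, ← span_singleton_mul_sup₃, sup₃_eq_top_of_unit_step, Ideal.mul_top]

/-- **Move 3 (A), `t`-chart**: `k · A₃(x′, y′, z, k)`. [folklore] -/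
theorem A2_3T (x' y' z k : A) : A23[k * x', k * y', z, k] = Ideal.span {k} * A33[x', y', z, k] := by
  have e1 : k * x' + k * y' = k * (x' + y') := by ring
  have e2 : z * k ^ 2 = k * (z * k) := by ring
  rw [e1, e2]
  exact (span_singleton_mul_sup₃ _ _ _ _).symm

/-- **Move 4 (A) is legal**: `A₃ ≤ (x, y, z)` (TMN tie with `V(x, y, t)`, free). [folklore] -/
theorem A3_3_le (x y z t : A) : A33[x, y, z, t] ≤ Ideal.span (Set.range ![x, y, z]) := by
  rw [span_range_vec3]
  refine sup_le (sup_le (le_sup_of_le_left le_sup_left) ?_) ?_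
  · rw [Ideal.span_singleton_le_iff_mem]
    exact Ideal.add_mem _ (Ideal.mem_sup_left (Ideal.mem_sup_left (Ideal.mem_span_singleton_self x)))
      (Ideal.mem_sup_left (Ideal.mem_sup_right (Ideal.mem_span_singleton_self y)))
  · rw [Ideal.span_singleton_le_iff_mem]
    exact Ideal.mem_sup_right (Ideal.mem_span_singleton.mpr ⟨t, by ring⟩)

/-- **Move 4 (A), `x`-chart**: `(l)`. [folklore] -/
theorem A3_3X (y' z' t l : A) : A33[l, l * y', l * z', t] = Ideal.span {l} :=
  span_sup_sup_eq ⟨1 + y', by ring⟩ ⟨z' * t, by ring⟩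

/-- **Move 4 (A), `y`-chart**: `l · ((x′) + (x′ + 1) + (z′ t)) = (l)`. [folklore] -/
theorem A3_3Y (x' z' t l : A) : A33[l * x', l, l * z', t] = Ideal.span {l} := by
  have e1 : l * x' + l = l * (x' + 1) := by ring
  have e2 : l * z' * t = l * (z' * t) := by ring
  rw [e1, e2, ← span_singleton_mul_sup₃, sup₃_eq_top_of_unit_step, Ideal.mul_top]

/-- **Move 4 (A), `z`-chart**: `l · C(x′, t, y′)` — the common last state with the roles `(x, z, t) := (x′, t, y′)`.
[folklore] -/
theorem A3_3Z (x' y' t l : A) : A33[l * x', l * y', l, t] = Ideal.span {l} * Cfin[x', t, y'] := by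
  have e1 : l * x' + l * y' = l * (x' + y') := by ring
  rw [e1]
  exact (span_singleton_mul_sup₃ _ _ _ _).symm

end DepthPhaseCRuns

end Summit.ResolutionOfSingularities.ResolutionOfSingularities.Theorems

end
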